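import Summits.BirchSwinnertonDyer.BirchSwinnertonDyer.Theorems.PrintX11aUpperNonSurjThreeSharpNakayama
import Literature.NumberTheory.EllipticCurves.IwasawaModuleFinitePadicIntProofs
import Mathlib.FieldTheory.Finiteness
import Mathlib.Algebra.Module.ZMod
import HarnessLib

/-!
# Route `PrintX11a`, child crux U3 = `PrintX11a.UpperNonSurjThree` (item stmt-BirchSwinnertonDyer-20613),
# line «finemu3», stub `FineMu.stub_conjA_three` — the ♯δ (LAYER) criterion PROVED:
# «`#(Sel₀(K_∞, E[p^∞])[p])^{γ^{pⁿ}} < p^{pⁿ}` ⟹ `Sel₀(K_∞, E[p^∞])[p]` finite ⟹ statement (A)» — the certificate that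
# reaches pairs with `X₀(E/ℚ_∞) ≠ 0` (cell `bsd-print-x11a`, width seat `bsd-line-x11a-p1-w2`; REF g17 note (ii) on p608099;
# `--supports` 20613; closes nothing)

HONEST FRAMING.  BSD is not proved by any of this; nothing is asserted about any curve; the crux and its stub
`stub_conjA_three` stay OPEN.  THEOREMS ONLY (no definition, no named fact, no `sorry`), all PROVED.

WHAT.  The ♯0 certificate (`…SharpDescent/Local/Defs`) books exactly the pairs with `Sel₀(ℚ_∞, E[p^∞]) = 0` (REF g17
booking note (ii)); U3 pairs carrying a fine `Ш[3]`-class need the line card's ♯δ («`dim Sel₀♯_1 ≤ p − 1 ⟹ r = 0 ⟹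
Sel₀♯ finite ⟹ (A)`», critic idea-crit-10 (P2)).  This file proves ♯δ at every layer `n`, in the sharpest counting
form and with an ELEMENTARY argument (no structure theory of `𝔽_p⟦T⟧`-modules):

* §1 (linear algebra): a locally nilpotent endomorphism `T` of an `𝔽_p`-vector space `M` with `#ker(T^k) < p^k` for
  some `k` has `M` FINITE — the kernels `ker T^j` increase; if they increased strictly up to `k` the `𝔽_p`-dimension of
  `ker T^k` would be `≥ k`; so `ker T^j = ker T^{j+1}` for some `j < k`, whence `ker T^{j+i} = ker T^j` for all `i` and,
  by local nilpotence, `M = ker T^j ⊆ ker T^k` is finite (`finite_of_natCard_ker_pow_lt`).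
* §2 (groups): for an additive endomorphism `ψ` of an abelian group `S`, locally nilpotent on `S[p]`:
  `#{s : p s = 0, ψ^k s = 0} < p^k ⟹ S[p]` finite (`finite_pTorsion_of_natCard_lt`; §1 on `S[p]` as a `ℤ/p`-module).
* §3 the Frobenius identity `(φ − 1)^{pⁿ} s = φ^{pⁿ} s − s` on `p`-torsion `s` (from the tree's
  `(X+1)^{pⁿ} − X^{pⁿ} − 1 ∈ pℤ[X]`), so `{p s = 0, (φ−1)^{pⁿ} s = 0} = {p s = 0, φ^{pⁿ} s = s}`.
* §4 (Iwasawa theory, any number field `K`, any `ℤ_p`-extension with top generator `γ`, any `W`):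
  **`#{s ∈ Sel₀(K_∞, E[p^∞]) : p s = 0, conj_{γ^{pⁿ}} s = s} < p^{pⁿ}` ⟹ `Sel₀(K_∞, E[p^∞])[p]` finite**
  (`finite_fineSelmerInfty_pTorsion_of_natCard_layer_lt`; `T = conj_γ − 1` is locally nilpotent on `Sel₀` by the tree's
  `isLocNil_conjFineSelmerInfty_sub_one`), hence the (A)-datum at `κ`
  (`IwasawaModuleFinitePadicInt.exists_fineSelmerDualData_moduleFinite_iff_finite_pTorsion`); over `ℚ`:
  `conjAAt_of_forall_natCard_layer_lt` and the `ClassX11a ∧ ¬Surj` door.  The case `n = 0` is ♯0 (`#Sel₀[p]^Γ < p`,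
  i.e. `= 0`); `n = 1` is the line card's ♯δ («`dim_{𝔽_p} Sel₀♯_1 ≤ p − 1`»).

WHAT STAYS ON PAPER.  The set counted in §4 is `Sel₀(K_∞, E[p^∞])[p]^{Γ_n}`, the `p`-torsion fine Selmer classes
fixed by `Γ_n = Γ^{pⁿ}`; its identification with the LEVEL-`n` residual group `R♯(E/K_n, p) ⊆ H¹(K_n, E[p])` (what an
engine computes on the layer `K_n`, e.g. `ℚ₁ = ℚ(ζ_{p²})⁺`, `[L₁ : ℚ] = 24/48` on U3) is Greenberg's §3 descent over
`K_n` — proved in the tree over the BASE (`…SharpDescent`, `n = 0`) but not yet transported to the layers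
(`-- TODO(layer descent): ZpDescent for κ restricted to layerSubgroup n`).  So for `n ≥ 1` a record displays the
level-∞ count as its hypothesis and REF audits the layer descent on paper.

References: [GreenbergLNM1716] §1 p. 60, §3 Lemmas 3.1–3.2; [CoatesSujatha2005] §3 statement (A); [Lang1990] Ch. 13
§1 Lemma 3 (first-layer behaviour); [Washington1997] §13.2; [LimSujatha2018] §3 ((A) ⟺ `R[p]` finite); line card
Lines/finemu3.md (P2) ♯δ; REF STATUS 2026-08-28T05:58:04Z (ii).
-/

set_option linter.dupNamespace false
set_option autoImplicit false

noncomputable section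

open scoped Classical

open WeierstrassCurve Field
  Literature.NumberTheory.EllipticCurves
  Literature.NumberTheory.EllipticCurves.Rank1Residual
  Summit.BirchSwinnertonDyer.Rank1Residual

namespace Summit.BirchSwinnertonDyer.BirchSwinnertonDyer.Theorems.UpperNonSurjThreeSharp

/-! ### §1 Linear algebra: a locally nilpotent `T` on an `𝔽_p`-space with `#ker T^k < p^k` has finite domain -/

section LinearAlgebra

variable {p : ℕ} [Fact p.Prime] {M : Type*} [AddCommGroup M] [Module (ZMod p) M]

/-- Kernels of powers increase: `ker T^j ≤ ker T^{j+1}`. [folklore] -/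
theorem ker_pow_le_ker_pow_succ (T : M →ₗ[ZMod p] M) (j : ℕ) :
    LinearMap.ker (T ^ j) ≤ LinearMap.ker (T ^ (j + 1)) := fun x hx ↦ by
  rw [LinearMap.mem_ker] at hx ⊢
  rw [pow_succ', Module.End.mul_apply, hx, map_zero]

/-- Kernels of powers increase: `ker T^i ≤ ker T^j` for `i ≤ j`. [folklore] -/
theorem ker_pow_mono (T : M →ₗ[ZMod p] M) {i j : ℕ} (h : i ≤ j) :
    LinearMap.ker (T ^ i) ≤ LinearMap.ker (T ^ j) := by
  induction h with
  | refl => exact le_rfl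
  | step _ ih => exact ih.trans (ker_pow_le_ker_pow_succ T _)

/-- Once two consecutive kernels agree they agree forever: `ker T^j = ker T^{j+1} ⟹ ker T^{j+i} = ker T^j`.
[folklore] -/
theorem ker_pow_add_eq_of_ker_pow_eq_succ (T : M →ₗ[ZMod p] M) {j : ℕ}
    (hj : LinearMap.ker (T ^ j) = LinearMap.ker (T ^ (j + 1))) (i : ℕ) :
    LinearMap.ker (T ^ (j + i)) = LinearMap.ker (T ^ j) := by
  induction i with
  | zero => rfl
  | succ i ih =>
    apply le_antisymm _ (ker_pow_mono T (by omega))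
    intro x hx
    -- `T x ∈ ker T^{j+i} = ker T^j`, so `x ∈ ker T^{j+1} = ker T^j`
    have hTx : T x ∈ LinearMap.ker (T ^ (j + i)) := by
      rw [LinearMap.mem_ker] at hx ⊢
      rw [← Module.End.mul_apply, ← pow_succ, show j + i + 1 = j + (i + 1) from rfl]
      exact hx
    rw [ih] at hTx
    have hx' : x ∈ LinearMap.ker (T ^ (j + 1)) := by
      rw [LinearMap.mem_ker] at hTx ⊢
      rw [pow_succ, Module.End.mul_apply]
      exact hTx
    rwa [← hj] at hx'

/-- **A locally nilpotent endomorphism of an `𝔽_p`-vector space with `#ker T^k < p^k` has FINITE domain.**  If the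
chain `ker T^0 < ker T^1 < ⋯ < ker T^k` were strict, `dim ker T^k ≥ k` and `#ker T^k = p^{dim} ≥ p^k`; so two
consecutive kernels agree below `k`, the chain is stationary from there, and local nilpotence puts every vector in
`ker T^j ⊆ ker T^k`, which is finite.  (Elementary substitute for the `𝔽_p⟦T⟧`-structure theorem behind
«`rank_p V_n = r pⁿ + O(1)`», Lang Ch. 13 §1 Lemma 3.) [cite: Lang1990, Ch. 13 §1 Lemma 3] -/
theorem finite_of_natCard_ker_pow_lt (T : M →ₗ[ZMod p] M) (hnil : ∀ x : M, ∃ N : ℕ, (T ^ N) x = 0) (k : ℕ)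
    [hfin : Finite (LinearMap.ker (T ^ k))] (hlt : Nat.card (LinearMap.ker (T ^ k)) < p ^ k) : Finite M := by
  have hp : p.Prime := Fact.out
  -- finiteness of the smaller kernels
  have hfinj : ∀ j, j ≤ k → Finite (LinearMap.ker (T ^ j)) := fun j hj ↦
    Finite.of_injective _ (Submodule.inclusion_injective (ker_pow_mono T hj))
  -- some two consecutive kernels below `k` agree
  have hex : ∃ j, j < k ∧ LinearMap.ker (T ^ j) = LinearMap.ker (T ^ (j + 1)) := by
    by_contra hne
    push Not at hne
    have hrank : ∀ j, j ≤ k → j ≤ Module.finrank (ZMod p) (LinearMap.ker (T ^ j)) := by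
      intro j
      induction j with
      | zero => intro; exact Nat.zero_le _
      | succ j ih =>
        intro hjk
        haveI : Finite (LinearMap.ker (T ^ (j + 1))) := hfinj (j + 1) hjk
        haveI : Module.Finite (ZMod p) (LinearMap.ker (T ^ (j + 1))) := Module.Finite.of_finite
        have hlt' : LinearMap.ker (T ^ j) < LinearMap.ker (T ^ (j + 1)) :=
          lt_of_le_of_ne (ker_pow_le_ker_pow_succ T j) (hne j (by omega))
        have := Submodule.finrank_lt_finrank_of_lt hlt'
        have := ih (by omega)
        omega
    haveI : Module.Finite (ZMod p) (LinearMap.ker (T ^ k)) := Module.Finite.of_finite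
    have hcard := Module.natCard_eq_pow_finrank (K := ZMod p) (V := LinearMap.ker (T ^ k))
    rw [Nat.card_zmod] at hcard
    have hle : p ^ k ≤ p ^ Module.finrank (ZMod p) (LinearMap.ker (T ^ k)) :=
      Nat.pow_le_pow_right hp.pos (hrank k le_rfl)
    omega
  obtain ⟨j, hjk, hj⟩ := hex
  -- every vector lies in `ker T^j`
  have hall : ∀ x : M, x ∈ LinearMap.ker (T ^ j) := fun x ↦ by
    obtain ⟨N, hN⟩ := hnil x
    have hx : x ∈ LinearMap.ker (T ^ (j + N)) := by
      rw [LinearMap.mem_ker, pow_add, Module.End.mul_apply, hN, map_zero]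
    rwa [ker_pow_add_eq_of_ker_pow_eq_succ T hj N] at hx
  haveI : Finite (LinearMap.ker (T ^ j)) := hfinj j hjk.le
  exact Finite.of_injective (fun x ↦ (⟨x, hall x⟩ : LinearMap.ker (T ^ j)))
    fun a b h ↦ by simpa using congrArg Subtype.val h

end LinearAlgebra

/-! ### §2 Abelian groups: `#{p s = 0, ψ^k s = 0} < p^k` ⟹ `S[p]` finite, for `ψ` locally nilpotent on `S[p]` -/

section Groups

variable {S : Type*} [AddCommGroup S] {p : ℕ}

variable [Fact p.Prime]

/-- **`#{s : p s = 0 ∧ ψ^k s = 0} < p^k ⟹ S[p]` finite**, for an additive endomorphism `ψ` of an abelian group `S`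
that is locally nilpotent on the `p`-torsion (§1 applied to `S[p]` as a `ℤ/p`-vector space).
[cite: Lang1990, Ch. 13 §1 Lemma 3] [cite: Washington1997, §13.2] -/
theorem finite_pTorsion_of_natCard_lt (ψ : AddMonoid.End S) (hnil : ∀ s : S, p • s = 0 → ∃ N : ℕ, (ψ ^ N) s = 0)
    (k : ℕ) (hfin : Set.Finite {s : S | p • s = 0 ∧ (ψ ^ k) s = 0})
    (hlt : Nat.card {s : S | p • s = 0 ∧ (ψ ^ k) s = 0} < p ^ k) :
    Set.Finite {s : S | p • s = 0} := by
  letI : Module (ZMod p) (AddSubgroup.torsionBy S p) := AddSubgroup.torsionBy.zmodModule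
  -- `ψ` restricted to `S[p]` (it commutes with `p•`), as a `ℤ/p`-linear endomorphism
  let ψP : AddSubgroup.torsionBy S p →+ AddSubgroup.torsionBy S p :=
    AddMonoidHom.mk' (fun x ↦ ⟨ψ x, AddSubgroup.torsionBy.nsmul_iff.mpr (by
        rw [← map_nsmul, AddSubgroup.torsionBy.nsmul_iff.mp x.2, map_zero])⟩)
      fun x y ↦ Subtype.ext (by simp [map_add])
  let T : AddSubgroup.torsionBy S p →ₗ[ZMod p] AddSubgroup.torsionBy S p := ψP.toZModLinearMap p
  have hT1 : ∀ x : AddSubgroup.torsionBy S p, ((T x : AddSubgroup.torsionBy S p) : S) = ψ (x : S) :=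
    fun _ ↦ rfl
  have hT : ∀ (j : ℕ) (x : AddSubgroup.torsionBy S p), (((T ^ j) x : AddSubgroup.torsionBy S p) : S) =
      (ψ ^ j) (x : S) := by
    intro j
    induction j with
    | zero => intro x; rw [pow_zero, pow_zero, Module.End.one_apply, AddMonoid.End.one_apply]
    | succ j ih =>
      intro x
      rw [pow_succ, Module.End.mul_apply, ih, hT1, pow_succ, AddMonoid.End.coe_mul, Function.comp_apply]
  -- the set `{p s = 0 ∧ ψ^k s = 0}` is `ker T^k`
  let e : {s : S | p • s = 0 ∧ (ψ ^ k) s = 0} ≃ LinearMap.ker (T ^ k) :=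
    { toFun := fun s ↦ ⟨⟨s.1, AddSubgroup.torsionBy.nsmul_iff.mpr s.2.1⟩, by
        rw [LinearMap.mem_ker]; exact Subtype.ext (by rw [hT]; exact s.2.2)⟩
      invFun := fun x ↦ ⟨((x : AddSubgroup.torsionBy S p) : S),
        ⟨AddSubgroup.torsionBy.nsmul_iff.mp x.1.2, by
          have hx := x.2; rw [LinearMap.mem_ker] at hx; rw [← hT, hx]; rfl⟩⟩
      left_inv := fun s ↦ rfl
      right_inv := fun x ↦ rfl }
  haveI : Finite {s : S | p • s = 0 ∧ (ψ ^ k) s = 0} := hfin.to_subtype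
  haveI : Finite (LinearMap.ker (T ^ k)) := Finite.of_equiv _ e
  have hcard : Nat.card (LinearMap.ker (T ^ k)) < p ^ k := by rwa [← Nat.card_congr e]
  have hnilT : ∀ x : AddSubgroup.torsionBy S p, ∃ N : ℕ, (T ^ N) x = 0 := fun x ↦ by
    obtain ⟨N, hN⟩ := hnil x (AddSubgroup.torsionBy.nsmul_iff.mp x.2)
    exact ⟨N, Subtype.ext (by rw [hT, hN]; rfl)⟩
  haveI : Finite (AddSubgroup.torsionBy S p) := finite_of_natCard_ker_pow_lt T hnilT k hcard
  have hset : {s : S | p • s = 0} = (AddSubgroup.torsionBy S p : Set S) := by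
    ext s; exact AddSubgroup.torsionBy.nsmul_iff.symm
  rw [hset]
  exact Set.toFinite _

/-! ### §3 The Frobenius identity `(φ − 1)^{pⁿ} s = φ^{pⁿ} s − s` on `p`-torsion -/

/-- **`(φ − 1)^{pⁿ} s = φ^{pⁿ} s − s` for `p`-torsion `s`**: evaluate the tree's `(X+1)^{pⁿ} − X^{pⁿ} − 1 = p·R(X)`
(`IwasawaDual.exists_X_add_one_pow_prime_pow`) at `X = φ − 1` and use `p • s = 0`.
[cite: Washington1997, §13.2 (`ω_n = (1+T)^{pⁿ} − 1`)] -/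
theorem pow_sub_one_prime_pow_apply_of_nsmul_eq_zero (φ : AddMonoid.End S) (n : ℕ) {s : S}
    (hs : p • s = 0) : ((φ - 1) ^ p ^ n) s = (φ ^ p ^ n) s - s := by
  have hp : p.Prime := Fact.out
  obtain ⟨R, hR⟩ := IwasawaDual.exists_X_add_one_pow_prime_pow hp n
  have h := congrArg (fun P : Polynomial ℤ ↦ Polynomial.aeval (φ - 1) P s) hR
  simp only [map_sub, map_mul, map_pow, map_add, Polynomial.aeval_X, map_one, sub_add_cancel,
    eq_intCast, map_intCast] at h
  rw [IwasawaDual.End_sub_apply, IwasawaDual.End_sub_apply, AddMonoid.End.one_apply,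
    IwasawaDual.End_intCast_mul_apply, natCast_zsmul, ← map_nsmul, hs, map_zero] at h
  -- h : (φ ^ p ^ n) s - ((φ - 1) ^ p ^ n) s - s = 0
  have h' : (φ ^ p ^ n) s - s - ((φ - 1) ^ p ^ n) s = 0 := by rw [← h]; abel
  exact (sub_eq_zero.mp h').symm

/-- The counted sets agree: for `p`-torsion `s`, `(φ − 1)^{pⁿ} s = 0 ↔ φ^{pⁿ} s = s`. [cite: Washington1997, §13.2] -/
theorem pow_sub_one_prime_pow_apply_eq_zero_iff (φ : AddMonoid.End S) (n : ℕ) {s : S} (hs : p • s = 0) :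
    ((φ - 1) ^ p ^ n) s = 0 ↔ (φ ^ p ^ n) s = s := by
  rw [pow_sub_one_prime_pow_apply_of_nsmul_eq_zero φ n hs, sub_eq_zero]

/-- **Layer form of §2**: for `ψ = φ − 1` locally nilpotent on `S[p]`,
`#{s : p s = 0 ∧ φ^{pⁿ} s = s} < p^{pⁿ} ⟹ S[p]` finite. [cite: Lang1990, Ch. 13 §1 Lemma 3] -/
theorem finite_pTorsion_of_natCard_fixed_lt (φ : AddMonoid.End S)
    (hnil : ∀ s : S, p • s = 0 → ∃ N : ℕ, ((φ - 1) ^ N) s = 0) (n : ℕ)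
    (hfin : Set.Finite {s : S | p • s = 0 ∧ (φ ^ p ^ n) s = s})
    (hlt : Nat.card {s : S | p • s = 0 ∧ (φ ^ p ^ n) s = s} < p ^ p ^ n) :
    Set.Finite {s : S | p • s = 0} := by
  have hset : {s : S | p • s = 0 ∧ ((φ - 1) ^ p ^ n) s = 0} = {s : S | p • s = 0 ∧ (φ ^ p ^ n) s = s} := by
    ext s
    simp only [Set.mem_setOf_eq]
    constructor
    · rintro ⟨h1, h2⟩; exact ⟨h1, (pow_sub_one_prime_pow_apply_eq_zero_iff φ n h1).mp h2⟩
    · rintro ⟨h1, h2⟩; exact ⟨h1, (pow_sub_one_prime_pow_apply_eq_zero_iff φ n h1).mpr h2⟩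
  refine finite_pTorsion_of_natCard_lt (φ - 1) hnil (p ^ n) (by rw [hset]; exact hfin) ?_
  have : Nat.card {s : S | p • s = 0 ∧ ((φ - 1) ^ p ^ n) s = 0} =
      Nat.card {s : S | p • s = 0 ∧ (φ ^ p ^ n) s = s} := by rw [hset]
  rw [this]; exact hlt

end Groups

/-! ### §4 The ♯δ criterion for `Sel₀(K_∞, E[p^∞])` at every layer, and statement (A) -/

section Selmer

universe u

variable {K : Type u} [Field K] [NumberField K] (W : WeierstrassCurve K) {p : ℕ} [Fact p.Prime]
  (κ : ZpExtension K p) {γ : absoluteGaloisGroup K}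

/-- **♯δ AT LAYER `n` — `#(Sel₀(K_∞, E[p^∞])[p])^{γ^{pⁿ}} < p^{pⁿ}` ⟹ `Sel₀(K_∞, E[p^∞])[p]` FINITE** — for any number
field `K`, any `ℤ_p`-extension `κ` with topological generator `γ`, any Weierstrass curve `W/K`.  (`T = conj_γ − 1` is
locally nilpotent on `Sel₀`, tree `isLocNil_conjFineSelmerInfty_sub_one`; §2–§3.)  `n = 0`: ♯0 (`#Sel₀[p]^Γ < p`);
`n = 1`: the line card's ♯δ «`dim_{𝔽_p} Sel₀♯_1 ≤ p − 1`».  PROVED, no named fact.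
[cite: GreenbergLNM1716, §1 (PDF p. 60)] [cite: Lang1990, Ch. 13 §1 Lemma 3] -/
theorem finite_fineSelmerInfty_pTorsion_of_natCard_layer_lt (hγ : κ.IsTopGenerator γ) (n : ℕ)
    (hfin : Set.Finite {s : W.fineSelmerInfty κ |
      p • s = 0 ∧ W.conjH1 p κ.kerSubgroup (γ ^ p ^ n) (s : W.subgroupH1 p κ.kerSubgroup) = s})
    (hlt : Nat.card {s : W.fineSelmerInfty κ |
      p • s = 0 ∧ W.conjH1 p κ.kerSubgroup (γ ^ p ^ n) (s : W.subgroupH1 p κ.kerSubgroup) = s} < p ^ p ^ n) :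
    Set.Finite {s : W.fineSelmerInfty κ | p • s = 0} := by
  have hset : {s : W.fineSelmerInfty κ | p • s = 0 ∧ ((W.conjFineSelmerInfty κ γ) ^ p ^ n) s = s} =
      {s : W.fineSelmerInfty κ |
        p • s = 0 ∧ W.conjH1 p κ.kerSubgroup (γ ^ p ^ n) (s : W.subgroupH1 p κ.kerSubgroup) = s} := by
    ext s
    simp only [Set.mem_setOf_eq]
    refine and_congr_right fun _ ↦ ?_
    rw [Subtype.ext_iff, coe_conjFineSelmerInfty_pow_apply]
  refine finite_pTorsion_of_natCard_fixed_lt (W.conjFineSelmerInfty κ γ)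
    (fun s _ ↦ (W.isLocNil_conjFineSelmerInfty_sub_one κ hγ).nil s) n (by rw [hset]; exact hfin) ?_
  have : Nat.card {s : W.fineSelmerInfty κ | p • s = 0 ∧ ((W.conjFineSelmerInfty κ γ) ^ p ^ n) s = s} =
      Nat.card {s : W.fineSelmerInfty κ |
        p • s = 0 ∧ W.conjH1 p κ.kerSubgroup (γ ^ p ^ n) (s : W.subgroupH1 p κ.kerSubgroup) = s} := by
    rw [hset]
  rw [this]; exact hlt

/-- **♯δ ⟹ the (A)-datum at `κ`**: under the layer-`n` count, the dual fine Selmer group over `K_∞` is finitely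
generated over `ℤ_p` for SOME datum (tree: (A) ⟺ `Sel₀[p]` finite,
`IwasawaModuleFinitePadicInt.exists_fineSelmerDualData_moduleFinite_iff_finite_pTorsion`).  PROVED; needs `W` elliptic.
[cite: CoatesSujatha2005, §3 statement (A)] [cite: LimSujatha2018, §3 (before Prop. 3.2)] -/
theorem exists_fineSelmerDualData_moduleFinite_of_natCard_layer_lt [W.IsElliptic] (hγ : κ.IsTopGenerator γ)
    (n : ℕ)
    (hfin : Set.Finite {s : W.fineSelmerInfty κ |
      p • s = 0 ∧ W.conjH1 p κ.kerSubgroup (γ ^ p ^ n) (s : W.subgroupH1 p κ.kerSubgroup) = s})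
    (hlt : Nat.card {s : W.fineSelmerInfty κ |
      p • s = 0 ∧ W.conjH1 p κ.kerSubgroup (γ ^ p ^ n) (s : W.subgroupH1 p κ.kerSubgroup) = s} < p ^ p ^ n) :
    ∃ (γ' : absoluteGaloisGroup K) (D : W.FineSelmerDualData κ γ'),
      Module.Finite ℤ_[p] (RestrictScalars ℤ_[p] (IwasawaAlgebra p) D.X) :=
  (IwasawaModuleFinitePadicInt.exists_fineSelmerDualData_moduleFinite_iff_finite_pTorsion W κ hγ).mpr
    (finite_fineSelmerInfty_pTorsion_of_natCard_layer_lt W κ hγ n hfin hlt)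

end Selmer

/-! ### §5 Over `ℚ`: statement (A) from the layer certificate, and the door on `ClassX11a ∧ ¬Surj` -/

section OverQ

variable (W : WeierstrassCurve ℚ) [W.IsElliptic] (p : ℕ) [Fact p.Prime]

/-- **Statement (A) at the pair from the layer-`n` ♯δ certificate** (`Rank1Residual.ConjAAt W p`, the conclusion of
`FineMu.stub_conjA_three` for THIS `W`): if for every cyclotomic `κ` and topological generator `γ` the `p`-torsion
fine Selmer classes over `ℚ_∞` fixed by `γ^{pⁿ}` number fewer than `p^{pⁿ}` (on paper: `dim_{𝔽_p} R♯(E/ℚ_n, p) < pⁿ`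
at the `n`-th layer `ℚ_n`), then (A) holds.  PROVED, no named fact, NO image / reduction hypothesis; (A) asserted
for no curve. [cite: CoatesSujatha2005, §3 statement (A)] [cite: Lang1990, Ch. 13 §1 Lemma 3] -/
theorem conjAAt_of_forall_natCard_layer_lt (n : ℕ)
    (h : ∀ (κ : ZpExtension ℚ p) (γ : absoluteGaloisGroup ℚ), κ.IsCyclotomic → κ.IsTopGenerator γ →
      Set.Finite {s : W.fineSelmerInfty κ |
          p • s = 0 ∧ W.conjH1 p κ.kerSubgroup (γ ^ p ^ n) (s : W.subgroupH1 p κ.kerSubgroup) = s} ∧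
        Nat.card {s : W.fineSelmerInfty κ |
          p • s = 0 ∧ W.conjH1 p κ.kerSubgroup (γ ^ p ^ n) (s : W.subgroupH1 p κ.kerSubgroup) = s} <
          p ^ p ^ n) :
    ConjAAt W p := by
  intro κ hκ
  obtain ⟨γ, hγ⟩ : ∃ γ : absoluteGaloisGroup ℚ, κ.IsTopGenerator γ := κ.surjective (Multiplicative.ofAdd 1)
  obtain ⟨hfin, hlt⟩ := h κ γ hκ hγ
  exact exists_fineSelmerDualData_moduleFinite_of_natCard_layer_lt W κ hγ n hfin hlt

/-- **♯δ door on the finemu3/finemu5 domain**: at a non-surjective X11a pair, the layer-`n` count gives statement (A)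
at the pair (the class/image hypotheses only fix the domain; the proof does not use them).  PROVED, no named fact.
[cite: CoatesSujatha2005, §3 statement (A)] -/
theorem _root_.Summit.BirchSwinnertonDyer.Rank1Residual.ClassX11a.conjAAt_of_not_surj_of_forall_natCard_layer_lt
    (W : WeierstrassCurve ℚ) [W.IsElliptic] [W.IsGloballyMinimal] (p : ℕ) [Fact p.Prime]
    (_hX : ClassX11a W p) (_hns : ¬ Surj W p) (n : ℕ)
    (h : ∀ (κ : ZpExtension ℚ p) (γ : absoluteGaloisGroup ℚ), κ.IsCyclotomic → κ.IsTopGenerator γ →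
      Set.Finite {s : W.fineSelmerInfty κ |
          p • s = 0 ∧ W.conjH1 p κ.kerSubgroup (γ ^ p ^ n) (s : W.subgroupH1 p κ.kerSubgroup) = s} ∧
        Nat.card {s : W.fineSelmerInfty κ |
          p • s = 0 ∧ W.conjH1 p κ.kerSubgroup (γ ^ p ^ n) (s : W.subgroupH1 p κ.kerSubgroup) = s} <
          p ^ p ^ n) :
    ConjAAt W p :=
  conjAAt_of_forall_natCard_layer_lt W p n h

end OverQ

end Summit.BirchSwinnertonDyer.BirchSwinnertonDyer.Theorems.UpperNonSurjThreeSharp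

end
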